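import Literature.NumberTheory.LFunctions.DobnerSelbergClassSteepestLargeProofs
import HarnessLib

/-!
# Dobner's Lemma 4 for `F ∈ 𝒮♯` — the contour step (pieces `V₁, V₂, H₁, H₂` of Lemma 6)

RH-FREE CONTENT (proof-internal steps of a published RH-free theorem, in the generality of the
extended Selberg class `𝒮♯`; no named facts, no definitions). Trunk T-ANT
(`Literature/NumberTheory/LFunctions`). Node **L4b** of the plan of record for the discharge of
`Literature.NumberTheory.LFunctions.dobner_theorem2` (HOME/drafts/rt/t7-N1-PLAN.md §3; rt-lead rulings
(15), (22), rt/STATUS 2026-08-26): the `D : ExtendedSelbergDatum` version of the `ζ`-case contour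
file (`Literature.NumberTheory.LFunctions.integral_dobnerI_two_eq`,
`Literature.NumberTheory.LFunctions.dobner_lemma4_contour` in `DobnerLemma4Proofs.lean`), built on the
steepest-descent vocabulary of `DobnerSelbergClassSteepest.lean`
(`Literature.NumberTheory.LFunctions.ExtendedSelbergDatum.dobnerJ`, `dobnerI`, `dobnerB`,
`dobnerCenter`, `poleHeight`, …).

> A. Dobner, *A proof of Newman's conjecture for the extended Selberg class*, Acta Arith. 201
> (2021) = arXiv:2005.05142, §4, proof of Lemma 4, p. 11: "By Cauchy's Theorem we can move the
> path of integration … the contour shift does not pass over any poles of the integrand (which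
> come from the Γ factors) because the imaginary parts of these poles are uniformly bounded
> above"; Lemma 6 (p. 11) and the display after it (p. 12): the pieces `V₁, H₁, H₂, V₂` contribute
> `O(e^{−c y^{4/3}})`; Lemma 1 (p. 5): `|γ(s)| ≤ e^{−K|Im s|}` for `|Re s| ≤ D|Im s|^θ`, `|Im s| ≥ T₀`.

## Contents (all theorems; `D : ExtendedSelbergDatum`, `0 < D.numGamma` where Lemma 1 is used)

* `γ` on the boxes of the contour: `ExtendedSelbergDatum.exists_norm_gamma_le_one_of_box`
  (`‖γ(z)‖ ≤ 1` for `|Re z| ≤ 4|Im z|^{3/5}`, `|Im z| ≥ T₁`: Lemma 1 with `θ = 3/5`) — together with the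
  imported one-constant bound on the line `Re z = 2`
  (`ExtendedSelbergDatum.exists_norm_gamma_two_le`, `DobnerSelbergClassSeriesProofs.lean`) this
  replaces the `ζ`-file's explicit `Γ`-bounds (`Γ(u) ≤ u^u`); no Stirling input is needed here;
* the integrand on the line `Re z = 2` and on horizontal segments:
  `ExtendedSelbergDatum.norm_dobnerI_two_le_gauss`, `norm_dobnerI_two_le` (away from the saddle,
  cf. Lemma 6 (ii)), `norm_dobnerI_horizontal_le` (cf. Lemma 6 (i));
* the contour identity `ExtendedSelbergDatum.integral_dobnerI_two_eq` (Cauchy on the rectangle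
  `[2, Re c] × [Im c − Y, Im c + Y]` inside `{Im z > poleHeight}`), the (private) numerical bookkeeping
  `dobner_contour_numerics_of_bound`, and the main estimate
  `ExtendedSelbergDatum.dobner_lemma4_contour`:
  `‖B_{t,n}(s) − (π|t|)^{-1/2} ∫_{−Y}^{Y} 𝓘(c + iu) du‖ ≤ e^{−(Im s)^{4/3}/(18|t|)}` for
  `|Re s| ≤ C (Im s)^{1/4}`, `Im s ≥ y₀(D, t, C)`, `1 ≤ n`, `log n ≤ (Im s)^{3/5}/|t|`, `c = s + log n/(2A)`,
  `Y = (Im s)^{2/3}` — verbatim the shape of the `ζ`-case `dobner_lemma4_contour`, so that the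
  saddle-segment/assembly files (nodes L4c-S / L4-ASM) consume it mechanically.

Imported interface (rt-lead rulings (22)/(25)/(26); first-landed names reused, not restated):
`ExtendedSelbergDatum.exists_norm_gamma_two_le`, `continuous_dobnerI_two`, `integrable_dobnerI_two`
(`DobnerSelbergClassSeriesProofs.lean`, node N1-a); `ExtendedSelbergDatum.dobnerJ_im_mem`,
`exists_abs_dobnerJ_re_sub_re_le`, `differentiableAt_dobnerI_of_re_pos`
(`DobnerSelbergClassSteepestLargeProofs.lean`, node L4a); `differentiableOn_dobnerI`,
`norm_dobnerI`, `norm_dobnerShift_le` (`DobnerSelbergClassSteepest.lean`, §1). As in the `ζ` file the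
horizontal pieces run at the fixed heights `Im c ∓ Y` (the source's are slanted), which changes
nothing in the estimates. Generic lemmas of the `ζ` files are reused verbatim
(`norm_integral_sub_intervalIntegral_le`, `integral_exp_neg_sq_sub_div`,
`integrable_exp_neg_sq_sub_div`, the `eventually_*_rpow` comparisons of `DobnerLemma4Tools.lean`).

bears_on: N-C/N-P (COLUMN 3 DBN). WHAT THIS IS NOT: the `ζ`-case `Λ ≥ 0` is already a theorem of
this library (`Literature.NumberTheory.LFunctions.rodgers_tao_holds`); `Λ_F ≥ 0` for `F ∈ 𝒮♯` is
RH-free literature; nothing here bears on the truth of RH.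
-/

noncomputable section

open Complex Filter Topology Set MeasureTheory intervalIntegral

namespace Literature.NumberTheory.LFunctions

/-! ## Elementary inequalities and the numerical bookkeeping -/

/-- Splitting a Gaussian away from its centre: if `|w| ≥ Y/2` then
`e^{−w²/τ} ≤ e^{−Y²/(8τ)} e^{−w²/(2τ)}`. [folklore] -/
private theorem exp_neg_sq_div_le_of_le_abs {τ Y w : ℝ} (hτ : 0 < τ) (hY : 0 ≤ Y) (hw : Y / 2 ≤ |w|) :
    Real.exp (-(w ^ 2 / τ)) ≤ Real.exp (-(Y ^ 2 / (8 * τ))) * Real.exp (-(w ^ 2 / (2 * τ))) := by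
  rw [← Real.exp_add, Real.exp_le_exp]
  have hw2 : Y ^ 2 / 4 ≤ w ^ 2 := by
    calc Y ^ 2 / 4 = (Y / 2) ^ 2 := by ring
      _ ≤ |w| ^ 2 := pow_le_pow_left₀ (by linarith) hw 2
      _ = w ^ 2 := sq_abs w
  have e : -(w ^ 2 / τ) = -(w ^ 2 / (2 * τ)) + -(w ^ 2 / (2 * τ)) := by field_simp; ring
  rw [e]
  have : Y ^ 2 / (8 * τ) ≤ w ^ 2 / (2 * τ) := by
    rw [div_le_div_iff₀ (by positivity) (by positivity)]; nlinarith
  linarith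

/-- `y^{3/5} ≤ 2 h^{3/5}` for `0 < y ≤ 2h` (`2^{3/5} ≤ 2`). [folklore] -/
private theorem rpow_three_fifths_le_two_mul {y h : ℝ} (hy : 0 < y) (hh : y ≤ 2 * h) :
    y ^ (3 / 5 : ℝ) ≤ 2 * h ^ (3 / 5 : ℝ) := by
  have hh0 : 0 < h := by linarith
  have h1 : y ^ (3 / 5 : ℝ) ≤ (2 * h) ^ (3 / 5 : ℝ) := Real.rpow_le_rpow hy.le hh (by norm_num)
  have h2 : (2 * h) ^ (3 / 5 : ℝ) = (2 : ℝ) ^ (3 / 5 : ℝ) * h ^ (3 / 5 : ℝ) :=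
    Real.mul_rpow (by norm_num) hh0.le
  have h3 : (2 : ℝ) ^ (3 / 5 : ℝ) ≤ 2 := by
    have := Real.rpow_le_rpow_of_exponent_le (one_le_two) (show (3 / 5 : ℝ) ≤ 1 by norm_num)
    rwa [Real.rpow_one] at this
  calc y ^ (3 / 5 : ℝ) ≤ (2 : ℝ) ^ (3 / 5 : ℝ) * h ^ (3 / 5 : ℝ) := h1.trans h2.le
    _ ≤ 2 * h ^ (3 / 5 : ℝ) := mul_le_mul_of_nonneg_right h3 (Real.rpow_nonneg hh0.le _)

/-- The numerical bookkeeping for `Literature.NumberTheory.LFunctions.ExtendedSelbergDatum.dobner_lemma4_contour`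
(variant of `Literature.NumberTheory.LFunctions.dobner_contour_numerics` with the `γ`-factor on the
line `Re z = 2` bounded by one constant `M ≥ 1`): the bounds of the outer and the horizontal pieces
add up to at most `e^{−y^{4/3}/(18τ)}` under the largeness conditions `hcondO`, `hcondHH`. [folklore] -/
private theorem dobner_contour_numerics_of_bound {τ y Jre M Y cτ : ℝ} (hτ : 0 < τ) (hy : 1 ≤ y)
    (hcτ : 0 < cτ) (hM : 1 ≤ M) (hcsqrt : cτ * Real.sqrt (2 * Real.pi * τ) ≤ 2)
    (hJre : |Jre| ≤ y ^ (3 / 5 : ℝ)) (h2 : 2 ≤ y ^ (3 / 5 : ℝ)) (hY : Y = y ^ (2 / 3 : ℝ))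
    (hcondO : Real.log (4 * M) + 4 * y ^ (6 / 5 : ℝ) / τ ≤ y ^ (4 / 3 : ℝ) / (15 * τ))
    (hcondHH : Real.log (8 * cτ) + 3 / 5 * Real.log y ≤ y ^ (4 / 3 : ℝ) / (10 * τ)) :
    cτ * (M * Real.exp ((Jre - 2) ^ 2 / τ) * Real.exp (-(Y ^ 2 / (8 * τ))) *
        Real.sqrt (2 * Real.pi * τ)) +
      cτ * (2 * (2 * y ^ (3 / 5 : ℝ) * Real.exp (-(y ^ (4 / 3 : ℝ) / (5 * τ))))) ≤
      Real.exp (-(y ^ (4 / 3 : ℝ) / (18 * τ))) := by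
  have hy0 : 0 < y := by linarith
  have hpi := Real.pi_gt_three
  have hM0 : 0 < M := by linarith
  -- the outer piece
  have f1 : Real.exp ((Jre - 2) ^ 2 / τ) ≤ Real.exp (4 * y ^ (6 / 5 : ℝ) / τ) := by
    refine Real.exp_le_exp.2 (div_le_div_of_nonneg_right ?_ hτ.le)
    have h1 : |Jre - 2| ≤ 2 * y ^ (3 / 5 : ℝ) := by
      calc |Jre - 2| ≤ |Jre| + |(2 : ℝ)| := abs_sub _ _
        _ ≤ y ^ (3 / 5 : ℝ) + 2 := by rw [abs_two]; linarith
        _ ≤ 2 * y ^ (3 / 5 : ℝ) := by linarith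
    have h65 : y ^ (3 / 5 : ℝ) * y ^ (3 / 5 : ℝ) = y ^ (6 / 5 : ℝ) := by
      rw [← Real.rpow_add hy0]; norm_num
    calc (Jre - 2) ^ 2 = |Jre - 2| ^ 2 := (sq_abs _).symm
      _ ≤ (2 * y ^ (3 / 5 : ℝ)) ^ 2 := pow_le_pow_left₀ (abs_nonneg _) h1 2
      _ = 4 * y ^ (6 / 5 : ℝ) := by rw [← h65]; ring
  have f3 : Real.exp (-(Y ^ 2 / (8 * τ))) = Real.exp (-(y ^ (4 / 3 : ℝ) / (8 * τ))) := by
    rw [hY, ← Real.rpow_natCast, ← Real.rpow_mul hy0.le]; norm_num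
  have hErr1 : cτ * (M * Real.exp ((Jre - 2) ^ 2 / τ) * Real.exp (-(Y ^ 2 / (8 * τ))) *
      Real.sqrt (2 * Real.pi * τ)) ≤ 1 / 2 * Real.exp (-(y ^ (4 / 3 : ℝ) / (18 * τ))) := by
    rw [f3]
    have hE0 : 0 ≤ M * Real.exp (4 * y ^ (6 / 5 : ℝ) / τ) * Real.exp (-(y ^ (4 / 3 : ℝ) / (8 * τ))) := by
      positivity
    calc cτ * (M * Real.exp ((Jre - 2) ^ 2 / τ) * Real.exp (-(y ^ (4 / 3 : ℝ) / (8 * τ))) *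
          Real.sqrt (2 * Real.pi * τ))
        ≤ cτ * (M * Real.exp (4 * y ^ (6 / 5 : ℝ) / τ) * Real.exp (-(y ^ (4 / 3 : ℝ) / (8 * τ))) *
          Real.sqrt (2 * Real.pi * τ)) := by gcongr
      _ = (cτ * Real.sqrt (2 * Real.pi * τ)) * (M * Real.exp (4 * y ^ (6 / 5 : ℝ) / τ) *
          Real.exp (-(y ^ (4 / 3 : ℝ) / (8 * τ)))) := by ring
      _ ≤ 2 * (M * Real.exp (4 * y ^ (6 / 5 : ℝ) / τ) *
          Real.exp (-(y ^ (4 / 3 : ℝ) / (8 * τ)))) := mul_le_mul_of_nonneg_right hcsqrt hE0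
      _ = 1 / 2 * Real.exp (Real.log (4 * M) + 4 * y ^ (6 / 5 : ℝ) / τ +
            -(y ^ (4 / 3 : ℝ) / (8 * τ))) := by
          rw [Real.exp_add, Real.exp_add, Real.exp_log (by positivity)]; ring
      _ ≤ 1 / 2 * Real.exp (-(y ^ (4 / 3 : ℝ) / (18 * τ))) := by
          gcongr 1 / 2 * ?_
          rw [Real.exp_le_exp]
          have hq : 0 ≤ y ^ (4 / 3 : ℝ) / τ := by positivity
          have e15 : y ^ (4 / 3 : ℝ) / (15 * τ) = y ^ (4 / 3 : ℝ) / τ / 15 := by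
            rw [div_div, mul_comm]
          have e8 : -(y ^ (4 / 3 : ℝ) / (8 * τ)) = -(y ^ (4 / 3 : ℝ) / τ / 8) := by
            rw [div_div, mul_comm]
          have e18 : -(y ^ (4 / 3 : ℝ) / (18 * τ)) = -(y ^ (4 / 3 : ℝ) / τ / 18) := by
            rw [div_div, mul_comm]
          rw [e15] at hcondO
          rw [e8, e18]
          linarith
  -- the horizontal pieces
  have hErr2 : cτ * (2 * (2 * y ^ (3 / 5 : ℝ) * Real.exp (-(y ^ (4 / 3 : ℝ) / (5 * τ))))) ≤
      1 / 2 * Real.exp (-(y ^ (4 / 3 : ℝ) / (18 * τ))) := by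
    have e35 : y ^ (3 / 5 : ℝ) = Real.exp (3 / 5 * Real.log y) := by
      rw [Real.rpow_def_of_pos hy0]; ring_nf
    have e1 : cτ * (2 * (2 * y ^ (3 / 5 : ℝ) * Real.exp (-(y ^ (4 / 3 : ℝ) / (5 * τ))))) =
        1 / 2 * Real.exp (Real.log (8 * cτ) + 3 / 5 * Real.log y + -(y ^ (4 / 3 : ℝ) / (5 * τ))) := by
      rw [Real.exp_add, Real.exp_add, Real.exp_log (by positivity), ← e35]; ring
    rw [e1]
    gcongr 1 / 2 * ?_
    rw [Real.exp_le_exp]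
    have hq : 0 ≤ y ^ (4 / 3 : ℝ) / τ := by positivity
    have e2 : y ^ (4 / 3 : ℝ) / (10 * τ) = y ^ (4 / 3 : ℝ) / τ / 10 := by
      rw [div_div, mul_comm]
    have e3 : -(y ^ (4 / 3 : ℝ) / (18 * τ)) = -(y ^ (4 / 3 : ℝ) / τ / 18) := by
      rw [div_div, mul_comm]
    have e4 : -(y ^ (4 / 3 : ℝ) / (5 * τ)) = -(y ^ (4 / 3 : ℝ) / τ / 5) := by
      rw [div_div, mul_comm]
    rw [e2] at hcondHH
    rw [e3, e4]
    linarith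
  calc _ ≤ 1 / 2 * Real.exp (-(y ^ (4 / 3 : ℝ) / (18 * τ))) +
        1 / 2 * Real.exp (-(y ^ (4 / 3 : ℝ) / (18 * τ))) := add_le_add hErr1 hErr2
    _ = _ := by ring

namespace ExtendedSelbergDatum

variable (D : ExtendedSelbergDatum)

/-! ## `γ` on the boxes of the contour: `‖γ‖ ≤ 1` via Lemma 1 -/

/-- **`‖γ(z)‖ ≤ 1` on the boxes of the contour**: there is `T₁ > 0` with `‖γ(z)‖ ≤ 1` whenever
`|Re z| ≤ 4|Im z|^{3/5}` and `|Im z| ≥ T₁` (`k ≥ 1`; Lemma 1 with `θ = 3/5`, `D = 4`).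
[cite: Dobner2021, Lemma 1, p. 5] -/
theorem exists_norm_gamma_le_one_of_box (hk : 0 < D.numGamma) :
    ∃ T₁ : ℝ, 0 < T₁ ∧ ∀ z : ℂ, |z.re| ≤ 4 * |z.im| ^ (3 / 5 : ℝ) → T₁ ≤ |z.im| → ‖D.gamma z‖ ≤ 1 := by
  obtain ⟨K, K', T₀, hK, -, hγ⟩ := dobner_lemma1_holds D.alpha D.polarOrder D.Q D.numGamma D.omega
    D.mu D.alpha_ne_zero D.Q_pos hk D.omega_pos D.mu_re_nonneg 4 (3 / 5) (by norm_num) (by norm_num)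
    (by norm_num)
  refine ⟨max T₀ 1, lt_of_lt_of_le one_pos (le_max_right _ _), fun z hre hT ↦ ?_⟩
  have h2 := (hγ z hre ((le_max_left _ _).trans hT)).2
  exact h2.trans (Real.exp_le_one_iff.2 (neg_nonpos.2 (by positivity)))

/-! ## The integrand on the line `Re z = 2` and on horizontal segments -/

/-- **Bound on the line `Re z = 2`**: if `‖γ(2+iv)‖ ≤ M` for all `v`, then
`‖𝓘(2+iv)‖ ≤ M e^{(Re J − 2)²/|t|} e^{−(Im J − v)²/|t|}` (`n ≥ 1`, `n^{−2} ≤ 1`).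
[cite: Dobner2021, Lemma 6 (ii), p. 11] -/
theorem norm_dobnerI_two_le_gauss {t : ℝ} (ht : t ≠ 0) {n : ℕ} (hn : 1 ≤ n) (s : ℂ) {M : ℝ}
    (hM : ∀ v : ℝ, ‖D.gamma (2 + v * I)‖ ≤ M) (v : ℝ) :
    ‖D.dobnerI t n s (2 + v * I)‖ ≤ M * Real.exp (((D.dobnerJ t s).re - 2) ^ 2 / |t|) *
      Real.exp (-(((D.dobnerJ t s).im - v) ^ 2 / |t|)) := by
  have ht' : 0 < |t| := abs_pos.2 ht
  have hre : ((2 : ℂ) + v * I).re = 2 := by simp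
  have him : ((2 : ℂ) + v * I).im = v := by simp
  rw [D.norm_dobnerI t hn, hre, him, sub_div, Real.exp_sub, div_eq_mul_inv (Real.exp _),
    ← Real.exp_neg]
  have hM0 : 0 ≤ M := (norm_nonneg (D.gamma (2 + (0 : ℝ) * I))).trans (hM 0)
  have hn1 : (1 : ℝ) ≤ n := by exact_mod_cast hn
  have f2 : (n : ℝ) ^ (-(2 : ℝ)) ≤ 1 := Real.rpow_le_one_of_one_le_of_nonpos hn1 (by norm_num)
  have h0 : 0 ≤ Real.exp (((D.dobnerJ t s).re - 2) ^ 2 / |t|) *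
      Real.exp (-(((D.dobnerJ t s).im - v) ^ 2 / |t|)) := by positivity
  have h1 : ‖D.gamma (2 + v * I)‖ * (n : ℝ) ^ (-(2 : ℝ)) ≤ M * 1 :=
    mul_le_mul (hM v) f2 (Real.rpow_nonneg n.cast_nonneg _) hM0
  calc ‖D.gamma (2 + v * I)‖ * (n : ℝ) ^ (-(2 : ℝ)) *
        (Real.exp (((D.dobnerJ t s).re - 2) ^ 2 / |t|) *
          Real.exp (-(((D.dobnerJ t s).im - v) ^ 2 / |t|)))
      ≤ M * 1 * (Real.exp (((D.dobnerJ t s).re - 2) ^ 2 / |t|) *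
          Real.exp (-(((D.dobnerJ t s).im - v) ^ 2 / |t|))) :=
        mul_le_mul_of_nonneg_right h1 h0
    _ = _ := by ring

/-- **The integrand on the line `Re z = 2` away from the saddle** (cf. [Dobner2021, Lemma 6 (ii)]):
if `‖γ(2+iv)‖ ≤ M` and `|v − Im J| ≥ Y/2`, then
`‖𝓘(2+iv)‖ ≤ M e^{(Re J−2)²/|t|} e^{−Y²/(8|t|)} e^{−(v − Im J)²/(2|t|)}`.
[cite: Dobner2021, Lemma 6 (ii), p. 11] -/
theorem norm_dobnerI_two_le {t : ℝ} (ht : t ≠ 0) {n : ℕ} (hn : 1 ≤ n) (s : ℂ) {M Y : ℝ}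
    (hM : ∀ v : ℝ, ‖D.gamma (2 + v * I)‖ ≤ M) (hY : 0 ≤ Y) (v : ℝ)
    (hw : Y / 2 ≤ |v - (D.dobnerJ t s).im|) :
    ‖D.dobnerI t n s (2 + v * I)‖ ≤
      M * Real.exp (((D.dobnerJ t s).re - 2) ^ 2 / |t|) * Real.exp (-(Y ^ 2 / (8 * |t|))) *
        Real.exp (-((v - (D.dobnerJ t s).im) ^ 2 / (2 * |t|))) := by
  have ht' : 0 < |t| := abs_pos.2 ht
  set J := D.dobnerJ t s with hJ
  have h1 := D.norm_dobnerI_two_le_gauss ht hn s hM v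
  rw [← hJ] at h1
  have hM0 : 0 ≤ M := (norm_nonneg _).trans (hM 0)
  have f5 := exp_neg_sq_div_le_of_le_abs ht' hY hw
  rw [show (J.im - v) ^ 2 = (v - J.im) ^ 2 by ring] at h1
  have hK0 : 0 ≤ M * Real.exp ((J.re - 2) ^ 2 / |t|) := by positivity
  calc ‖D.dobnerI t n s (2 + v * I)‖
      ≤ M * Real.exp ((J.re - 2) ^ 2 / |t|) * Real.exp (-((v - J.im) ^ 2 / |t|)) := h1
    _ ≤ M * Real.exp ((J.re - 2) ^ 2 / |t|) *
        (Real.exp (-(Y ^ 2 / (8 * |t|))) * Real.exp (-((v - J.im) ^ 2 / (2 * |t|)))) :=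
        mul_le_mul_of_nonneg_left f5 hK0
    _ = _ := by ring

/-- **The integrand on the horizontal pieces** (cf. [Dobner2021, Lemma 6 (i)]): for `y > 0`,
`‖γ(r + ih)‖ ≤ 1`, `|r| ≤ 2y^{3/5}`, `log n ≤ y^{3/5}/|t|`, `|Re J| ≤ y^{3/5}`,
`|Im J − h| ≥ y^{2/3}/2` and the numerical largeness condition `hcond`:
`‖𝓘(r + ih)‖ ≤ e^{−y^{4/3}/(5|t|)}` (`n^{−r} ≤ e^{2y^{6/5}/|t|}`, `Re((J − z)²) ≤ 9y^{6/5} − y^{4/3}/4`).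
[cite: Dobner2021, Lemma 6 (i), p. 11] -/
theorem norm_dobnerI_horizontal_le {t : ℝ} (ht : t ≠ 0) {n : ℕ} (hn : 1 ≤ n) (s : ℂ)
    {y r h : ℝ} (hy : 0 < y) (hγ : ‖D.gamma (r + h * I)‖ ≤ 1) (hr : |r| ≤ 2 * y ^ (3 / 5 : ℝ))
    (hℓ : Real.log n ≤ y ^ (3 / 5 : ℝ) / |t|) (hJre : |(D.dobnerJ t s).re| ≤ y ^ (3 / 5 : ℝ))
    (hJim : y ^ (2 / 3 : ℝ) / 2 ≤ |(D.dobnerJ t s).im - h|)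
    (hcond : 11 * y ^ (6 / 5 : ℝ) / |t| ≤ y ^ (4 / 3 : ℝ) / (20 * |t|)) :
    ‖D.dobnerI t n s (r + h * I)‖ ≤ Real.exp (-(y ^ (4 / 3 : ℝ) / (5 * |t|))) := by
  have ht' : 0 < |t| := abs_pos.2 ht
  set J := D.dobnerJ t s with hJ
  set z : ℂ := r + h * I with hz
  have hzre : z.re = r := by simp [hz]
  have hzim : z.im = h := by simp [hz]
  rw [D.norm_dobnerI t hn, hzre, hzim]
  -- `n^{-r} ≤ exp(2 y^{6/5}/|t|)`
  have hnr : (n : ℝ) ^ (-r) ≤ Real.exp (2 * y ^ (6 / 5 : ℝ) / |t|) := by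
    have hn0 : (0 : ℝ) < n := by exact_mod_cast hn
    rw [Real.rpow_def_of_pos hn0, Real.exp_le_exp]
    have hℓ0 : 0 ≤ Real.log n := Real.log_natCast_nonneg n
    have h65 : y ^ (3 / 5 : ℝ) * y ^ (3 / 5 : ℝ) = y ^ (6 / 5 : ℝ) := by
      rw [← Real.rpow_add hy]; norm_num
    calc Real.log n * -r ≤ Real.log n * |r| := by
          exact mul_le_mul_of_nonneg_left (neg_le_abs r) hℓ0
      _ ≤ (y ^ (3 / 5 : ℝ) / |t|) * (2 * y ^ (3 / 5 : ℝ)) :=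
          mul_le_mul hℓ hr (abs_nonneg r) (by positivity)
      _ = 2 * y ^ (6 / 5 : ℝ) / |t| := by rw [← h65]; field_simp
  -- the Gaussian: `((Re J − r)² − (Im J − h)²)/|t| ≤ (9 y^{6/5} − y^{4/3}/4)/|t|`
  have hgauss : ((J.re - r) ^ 2 - (J.im - h) ^ 2) / |t| ≤
      (9 * y ^ (6 / 5 : ℝ) - y ^ (4 / 3 : ℝ) / 4) / |t| := by
    refine div_le_div_of_nonneg_right ?_ ht'.le
    have h1 : |J.re - r| ≤ 3 * y ^ (3 / 5 : ℝ) := by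
      calc |J.re - r| ≤ |J.re| + |r| := abs_sub _ _
        _ ≤ y ^ (3 / 5 : ℝ) + 2 * y ^ (3 / 5 : ℝ) := add_le_add hJre hr
        _ = 3 * y ^ (3 / 5 : ℝ) := by ring
    have h2 : (J.re - r) ^ 2 ≤ 9 * y ^ (6 / 5 : ℝ) := by
      have h65 : y ^ (3 / 5 : ℝ) * y ^ (3 / 5 : ℝ) = y ^ (6 / 5 : ℝ) := by
        rw [← Real.rpow_add hy]; norm_num
      calc (J.re - r) ^ 2 = |J.re - r| ^ 2 := (sq_abs _).symm
        _ ≤ (3 * y ^ (3 / 5 : ℝ)) ^ 2 := pow_le_pow_left₀ (abs_nonneg _) h1 2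
        _ = 9 * y ^ (6 / 5 : ℝ) := by rw [← h65]; ring
    have h3 : y ^ (4 / 3 : ℝ) / 4 ≤ (J.im - h) ^ 2 := by
      have h43 : y ^ (2 / 3 : ℝ) * y ^ (2 / 3 : ℝ) = y ^ (4 / 3 : ℝ) := by
        rw [← Real.rpow_add hy]; norm_num
      calc y ^ (4 / 3 : ℝ) / 4 = (y ^ (2 / 3 : ℝ) / 2) ^ 2 := by rw [← h43]; ring
        _ ≤ |J.im - h| ^ 2 := pow_le_pow_left₀ (by positivity) hJim 2
        _ = (J.im - h) ^ 2 := sq_abs _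
    linarith
  -- assemble
  have hn0' : 0 ≤ (n : ℝ) ^ (-r) := Real.rpow_nonneg n.cast_nonneg _
  calc ‖D.gamma z‖ * (n : ℝ) ^ (-r) * Real.exp (((J.re - r) ^ 2 - (J.im - h) ^ 2) / |t|)
      ≤ 1 * Real.exp (2 * y ^ (6 / 5 : ℝ) / |t|) *
          Real.exp ((9 * y ^ (6 / 5 : ℝ) - y ^ (4 / 3 : ℝ) / 4) / |t|) :=
        mul_le_mul (mul_le_mul hγ hnr hn0' zero_le_one) (Real.exp_le_exp.2 hgauss)
          (Real.exp_pos _).le (by positivity)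
    _ ≤ Real.exp (-(y ^ (4 / 3 : ℝ) / (5 * |t|))) := by
        rw [one_mul, ← Real.exp_add, Real.exp_le_exp]
        have e : -(y ^ (4 / 3 : ℝ) / (5 * |t|)) =
            y ^ (4 / 3 : ℝ) / (20 * |t|) + (-(y ^ (4 / 3 : ℝ) / 4)) / |t| := by
          field_simp; ring
        rw [e]
        have e2 : (9 * y ^ (6 / 5 : ℝ) - y ^ (4 / 3 : ℝ) / 4) / |t| =
            9 * y ^ (6 / 5 : ℝ) / |t| + (-(y ^ (4 / 3 : ℝ) / 4)) / |t| := by ring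
        rw [e2]
        have e3 : 11 * y ^ (6 / 5 : ℝ) / |t| = 2 * y ^ (6 / 5 : ℝ) / |t| + 9 * y ^ (6 / 5 : ℝ) / |t| := by
          ring
        rw [e3] at hcond
        linarith

/-! ## The contour identity -/

/-- **The contour shift** (Cauchy's theorem on the rectangle `[2, Re c] × [Im c − Y, Im c + Y]`,
which lies in the half-plane `{Im z > poleHeight}` where `𝓘` is holomorphic — "the contour shift
does not pass over any poles of the integrand", p. 11): for `n ≥ 1`, `Y > 0` and
`Im c − Y > poleHeight`,
`∫ 𝓘(2+iv) dv = (∫ 𝓘(2+iv) dv − ∫_{Im c−Y}^{Im c+Y} 𝓘(2+iv) dv) + ∫_{−Y}^{Y} 𝓘(c+iu) du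
 − i (∫_2^{Re c} 𝓘(r + i(Im c−Y)) dr − ∫_2^{Re c} 𝓘(r + i(Im c+Y)) dr)`.
[cite: Dobner2021, proof of Lemma 4 (Cauchy's theorem display, p. 11)] -/
theorem integral_dobnerI_two_eq (t : ℝ) {n : ℕ} (hn : 1 ≤ n) (s c : ℂ) {Y : ℝ} (hY : 0 < Y)
    (hc : D.poleHeight < c.im - Y) :
    ∫ v : ℝ, D.dobnerI t n s (2 + v * I) =
      ((∫ v : ℝ, D.dobnerI t n s (2 + v * I)) -
          ∫ v in (c.im - Y)..(c.im + Y), D.dobnerI t n s (2 + v * I)) +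
        (∫ u in (-Y)..Y, D.dobnerI t n s (c + u * I)) -
        I * ((∫ r in (2 : ℝ)..c.re, D.dobnerI t n s (r + ((c.im - Y : ℝ) : ℂ) * I)) -
          ∫ r in (2 : ℝ)..c.re, D.dobnerI t n s (r + ((c.im + Y : ℝ) : ℂ) * I)) := by
  set F := D.dobnerI t n s with hF
  -- Cauchy on the rectangle
  have hdiff : DifferentiableOn ℂ F (Set.uIcc (2 : ℝ) c.re ×ℂ Set.uIcc (c.im - Y) (c.im + Y)) := by
    refine (D.differentiableOn_dobnerI t hn s).mono fun z hz ↦ ?_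
    have h2 : z.im ∈ Set.uIcc (c.im - Y) (c.im + Y) := hz.2
    rw [Set.uIcc_of_le (by linarith)] at h2
    exact hc.trans_le h2.1
  have hrect := Complex.integral_boundary_rect_eq_zero_of_differentiableOn F ⟨2, c.im - Y⟩
    ⟨c.re, c.im + Y⟩ hdiff
  change (∫ x : ℝ in (2 : ℝ)..c.re, F (x + ((c.im - Y : ℝ) : ℂ) * I)) -
      (∫ x : ℝ in (2 : ℝ)..c.re, F (x + ((c.im + Y : ℝ) : ℂ) * I)) +
      I • (∫ y : ℝ in (c.im - Y)..(c.im + Y), F (((c.re : ℝ) : ℂ) + y * I)) -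
      I • (∫ y : ℝ in (c.im - Y)..(c.im + Y), F ((((2 : ℝ) : ℝ) : ℂ) + y * I)) = 0 at hrect
  simp only [Complex.ofReal_ofNat, smul_eq_mul] at hrect
  -- the middle vertical piece is `∫_{-Y}^{Y} F(c + iu) du`
  have hM : ∫ y : ℝ in (c.im - Y)..(c.im + Y), F ((c.re : ℂ) + y * I) =
      ∫ u in (-Y)..Y, F (c + u * I) := by
    have h := intervalIntegral.integral_comp_add_right (a := -Y) (b := Y)
      (fun y : ℝ ↦ F ((c.re : ℂ) + y * I)) c.im
    rw [show -Y + c.im = c.im - Y by ring, show Y + c.im = c.im + Y by ring] at h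
    rw [← h]
    congr 1; funext u
    congr 1
    apply Complex.ext <;> simp [add_comm]
  rw [hM] at hrect
  set V := ∫ y : ℝ in (c.im - Y)..(c.im + Y), F (2 + y * I)
  set M := ∫ u in (-Y)..Y, F (c + u * I)
  set H1 := ∫ x : ℝ in (2 : ℝ)..c.re, F (x + ((c.im - Y : ℝ) : ℂ) * I)
  set H2 := ∫ x : ℝ in (2 : ℝ)..c.re, F (x + ((c.im + Y : ℝ) : ℂ) * I)
  have hI : I * I = -1 := Complex.I_mul_I
  linear_combination I * hrect + (V - M) * hI

/-! ## The main estimate of this file -/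

set_option maxHeartbeats 400000 in
/-- **Dobner's Lemma 4, the contour step, for `F ∈ 𝒮♯`**: for `k ≥ 1`, `t < 0` and real `C`
there is `y₀` such that for `|Re s| ≤ C (Im s)^{1/4}`, `Im s ≥ y₀`, `n ≥ 1`,
`log n ≤ (Im s)^{3/5}/|t|`, with `c = s + log n/(2A)` and `Y = (Im s)^{2/3}`:
`‖B_{t,n}(s) − (π|t|)^{-1/2} ∫_{−Y}^{Y} 𝓘(c + iu) du‖ ≤ e^{−(Im s)^{4/3}/(18|t|)}`
(the pieces `V₁, H₁, H₂, V₂` of [Dobner2021, p. 12]; same shape as the `ζ`-case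
`Literature.NumberTheory.LFunctions.dobner_lemma4_contour`). [cite: Dobner2021, proof of Lemma 4 (i),(ii), pp. 11–12] -/
theorem dobner_lemma4_contour (hk : 0 < D.numGamma) {t : ℝ} (ht : t < 0) (C : ℝ) :
    ∃ y₀ : ℝ, ∀ s : ℂ, |s.re| ≤ C * s.im ^ (1 / 4 : ℝ) → y₀ ≤ s.im → ∀ n : ℕ, 1 ≤ n →
      Real.log n ≤ s.im ^ (3 / 5 : ℝ) / |t| →
        ‖D.dobnerB t n s - ((1 / Real.sqrt (Real.pi * |t|) : ℝ) : ℂ) *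
            ∫ u in (-(s.im ^ (2 / 3 : ℝ)))..(s.im ^ (2 / 3 : ℝ)),
              D.dobnerI t n s (D.dobnerCenter t n s + u * I)‖ ≤
          Real.exp (-(s.im ^ (4 / 3 : ℝ) / (18 * |t|))) := by
  have ht0 : t ≠ 0 := ht.ne
  have hτ : 0 < |t| := abs_pos.2 ht0
  set τ : ℝ := |t| with hτdef
  have hpi := Real.pi_gt_three
  have hpi4 := Real.pi_le_four
  set cτ : ℝ := 1 / Real.sqrt (Real.pi * τ) with hcτ
  have hcτ0 : 0 < cτ := by positivity
  -- the datum's constants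
  set W : ℝ := D.omegaSum with hWdef
  have hW0 : 0 ≤ W := D.omegaSum_nonneg
  set P : ℝ := D.poleHeight with hPdef
  have hP0 : 0 ≤ P := D.poleHeight_nonneg
  set κ : ℝ := Real.pi * τ / 2 * W with hκ
  have hκ0 : 0 ≤ κ := by positivity
  -- `γ` on the line `Re z = 2` (one constant `M ≥ 1`) and on the boxes (`≤ 1`); the size of `Re J`
  obtain ⟨M', hM'0, hM'⟩ := D.exists_norm_gamma_two_le hk
  set M : ℝ := max 1 M' with hMdef
  have hM1 : 1 ≤ M := le_max_left _ _
  have hM0 : 0 < M := by linarith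
  have hM : ∀ v : ℝ, ‖D.gamma (2 + v * I)‖ ≤ M := fun v ↦ (hM' v).trans (le_max_right _ _)
  obtain ⟨T₁, hT₁, hbox⟩ := D.exists_norm_gamma_le_one_of_box hk
  obtain ⟨c₀, c₁, hc₀, hc₁, hJK⟩ := D.exists_abs_dobnerJ_re_sub_re_le t
  -- largeness conditions on `y`
  have evA : ∀ᶠ y : ℝ in atTop, 8 ≤ y ∧ 4 * P + 4 ≤ y ∧ 2 * τ * W ≤ y ∧ 2 * T₁ ≤ y := by
    filter_upwards [eventually_ge_atTop (8 : ℝ), eventually_ge_atTop (4 * P + 4),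
      eventually_ge_atTop (2 * τ * W), eventually_ge_atTop (2 * T₁)] with y h1 h2 h3 h4
    exact ⟨h1, h2, h3, h4⟩
  have evB : ∀ᶠ y : ℝ in atTop, C * y ^ (1 / 4 : ℝ) + c₀ + c₁ * Real.log y ≤ y ^ (3 / 5 : ℝ) ∧
      2 + C * y ^ (1 / 4 : ℝ) ≤ y ^ (3 / 5 : ℝ) ∧ 2 ≤ y ^ (3 / 5 : ℝ) := by
    filter_upwards [eventually_const_mul_rpow_le_rpow (3 * C) (by norm_num : (1 / 4 : ℝ) < 3 / 5),
      eventually_const_le_rpow (3 * c₀) (by norm_num : (0 : ℝ) < 3 / 5),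
      eventually_const_mul_log_le_rpow (3 * c₁) (by norm_num : (0 : ℝ) < 3 / 5),
      eventually_const_le_rpow (6 : ℝ) (by norm_num : (0 : ℝ) < 3 / 5)] with y h1 h2 h3 h4
    exact ⟨by linarith, by linarith, by linarith⟩
  have evC : ∀ᶠ y : ℝ in atTop, 2 * y ^ (3 / 5 : ℝ) ≤ y / 4 ∧ y ^ (2 / 3 : ℝ) ≤ y / 4 ∧
      y ^ (3 / 5 : ℝ) + κ ≤ y ^ (2 / 3 : ℝ) / 2 := by
    filter_upwards [eventually_const_mul_rpow_le_rpow 8 (by norm_num : (3 / 5 : ℝ) < 1),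
      eventually_const_mul_rpow_le_rpow 4 (by norm_num : (2 / 3 : ℝ) < 1),
      eventually_const_mul_rpow_le_rpow 4 (by norm_num : (3 / 5 : ℝ) < 2 / 3),
      eventually_const_le_rpow (4 * κ) (by norm_num : (0 : ℝ) < 2 / 3)] with y h1 h2 h3 h4
    rw [Real.rpow_one] at h1 h2
    exact ⟨by linarith, by linarith, by linarith⟩
  have evD : ∀ᶠ y : ℝ in atTop, 11 * y ^ (6 / 5 : ℝ) / τ ≤ y ^ (4 / 3 : ℝ) / (20 * τ) := by
    filter_upwards [eventually_const_mul_rpow_le_rpow (20 * 11) (by norm_num : (6 / 5 : ℝ) < 4 / 3)]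
      with y h1
    rw [div_le_div_iff₀ hτ (by positivity)]
    calc 11 * y ^ (6 / 5 : ℝ) * (20 * τ) = (20 * 11 * y ^ (6 / 5 : ℝ)) * τ := by ring
      _ ≤ y ^ (4 / 3 : ℝ) * τ := mul_le_mul_of_nonneg_right h1 hτ.le
  have evE : ∀ᶠ y : ℝ in atTop,
      Real.log (4 * M) + 4 * y ^ (6 / 5 : ℝ) / τ ≤ y ^ (4 / 3 : ℝ) / (15 * τ) ∧
        Real.log (8 * cτ) + 3 / 5 * Real.log y ≤ y ^ (4 / 3 : ℝ) / (10 * τ) := by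
    filter_upwards [eventually_const_le_rpow (30 * τ * Real.log (4 * M)) (by norm_num : (0 : ℝ) < 4 / 3),
      eventually_const_mul_rpow_le_rpow (30 * 4) (by norm_num : (6 / 5 : ℝ) < 4 / 3),
      eventually_const_le_rpow (20 * τ * Real.log (8 * cτ)) (by norm_num : (0 : ℝ) < 4 / 3),
      eventually_const_mul_log_le_rpow (20 * τ * (3 / 5)) (by norm_num : (0 : ℝ) < 4 / 3)]
      with y h1 h2 h3 h4
    constructor
    · rw [le_div_iff₀ (by positivity)]
      have e : (Real.log (4 * M) + 4 * y ^ (6 / 5 : ℝ) / τ) * (15 * τ) =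
          15 * τ * Real.log (4 * M) + 60 * y ^ (6 / 5 : ℝ) := by
        field_simp; ring
      rw [e]; linarith
    · rw [le_div_iff₀ (by positivity)]
      linarith
  obtain ⟨y₀, hy₀⟩ := eventually_atTop.1 ((evA.and evB).and ((evC.and evD).and evE))
  refine ⟨y₀, fun s hx hy n hn hℓ ↦ ?_⟩
  obtain ⟨⟨⟨hy8, hyP, hyW, hyT⟩, ⟨hJb, hcre, h2y35⟩⟩, ⟨⟨hy35, hy23, hYc⟩, hcondH⟩, hcondO,
    hcondHH⟩ := hy₀ s.im hy
  -- notation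
  set y : ℝ := s.im with hydef
  set x : ℝ := s.re with hxdef
  set ℓ : ℝ := Real.log n with hℓdef
  set J : ℂ := D.dobnerJ t s with hJdef
  set lam : ℂ := D.dobnerShift t n s with hlam
  set c : ℂ := D.dobnerCenter t n s with hcdef
  set Y : ℝ := y ^ (2 / 3 : ℝ) with hYdef
  have hy0 : 0 < y := by linarith
  have hy1 : 1 ≤ y := by linarith
  have hY0 : 0 < Y := Real.rpow_pos_of_pos hy0 _
  have h35 : 0 ≤ y ^ (3 / 5 : ℝ) := Real.rpow_nonneg hy0.le _
  have hsP : 2 * P ≤ y := by linarith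
  have hPs : P < y := by linarith
  have hxb : |x| ≤ C * y ^ (1 / 4 : ℝ) := hx
  have hxy : |x| ≤ y := by linarith
  -- sizes of `λ`, `c`, `J`
  have hlam1 : ‖lam‖ ≤ y ^ (3 / 5 : ℝ) := by
    have h1 := D.norm_dobnerShift_le ht0 (s := s) hy0 hsP hyW hn
    rw [← hlam, ← hℓdef] at h1
    calc ‖lam‖ ≤ τ * ℓ := h1
      _ ≤ τ * (y ^ (3 / 5 : ℝ) / τ) := mul_le_mul_of_nonneg_left hℓ hτ.le
      _ = y ^ (3 / 5 : ℝ) := by field_simp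
  have hlam_re : |lam.re| ≤ y ^ (3 / 5 : ℝ) := (Complex.abs_re_le_norm _).trans hlam1
  have hlam_im : |lam.im| ≤ y ^ (3 / 5 : ℝ) := (Complex.abs_im_le_norm _).trans hlam1
  have hc_re : c.re = x + lam.re := by rw [hcdef, dobnerCenter, Complex.add_re]
  have hc_im : c.im = y + lam.im := by rw [hcdef, dobnerCenter, Complex.add_im]
  have hcre_abs : |c.re| + 2 ≤ 2 * y ^ (3 / 5 : ℝ) := by
    rw [hc_re]
    have := abs_add_le x lam.re
    linarith
  have hJre0 : |J.re| ≤ y ^ (3 / 5 : ℝ) := by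
    have h1 := hJK s hy1 hsP hxy
    rw [← hJdef, ← hxdef, ← hydef] at h1
    calc |J.re| = |(J.re - x) + x| := by ring_nf
      _ ≤ |J.re - x| + |x| := abs_add_le _ _
      _ ≤ (c₀ + c₁ * Real.log y) + C * y ^ (1 / 4 : ℝ) := add_le_add h1 hxb
      _ ≤ y ^ (3 / 5 : ℝ) := by linarith
  have hJim := D.dobnerJ_im_mem t (s := s) hPs
  rw [← hJdef, ← hydef] at hJim
  have hJim0 : 0 < J.im := by linarith [hJim.1]
  have hJimκ : J.im ≤ y + κ := by rw [hκ, hWdef]; linarith [hJim.2]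
  -- the heights `h₁ = Im c − Y`, `h₂ = Im c + Y`
  have hh1 : y / 2 ≤ c.im - Y := by
    rw [hc_im]; linarith [(abs_le.1 hlam_im).1]
  have hh1P : P < c.im - Y := by linarith
  have hh2 : c.im + Y ≤ 2 * y := by rw [hc_im]; linarith [(abs_le.1 hlam_im).2]
  have hJh1 : Y / 2 ≤ |J.im - (c.im - Y)| := by
    rw [hc_im]
    have : Y / 2 ≤ J.im - (y + lam.im - Y) := by linarith [hJim.1, (abs_le.1 hlam_im).2]
    exact this.trans (le_abs_self _)
  have hJh2 : Y / 2 ≤ |J.im - (c.im + Y)| := by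
    rw [hc_im]
    have : Y / 2 ≤ (y + lam.im + Y) - J.im := by linarith [(abs_le.1 hlam_im).1]
    rw [abs_sub_comm]; exact this.trans (le_abs_self _)
  -- Step 1: the contour identity
  have hident := D.integral_dobnerI_two_eq t hn s c hY0 hh1P
  -- Step 2: the horizontal pieces (`‖γ‖ ≤ 1` on them by Lemma 1)
  have hH : ∀ h : ℝ, (h = c.im - Y ∨ h = c.im + Y) →
      ‖∫ r in (2 : ℝ)..c.re, D.dobnerI t n s (r + (h : ℂ) * I)‖ ≤
        2 * y ^ (3 / 5 : ℝ) * Real.exp (-(y ^ (4 / 3 : ℝ) / (5 * τ))) := by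
    intro h hh
    have hhge : y / 2 ≤ h := by rcases hh with rfl | rfl <;> linarith
    have hhle : h ≤ 2 * y := by rcases hh with rfl | rfl <;> linarith
    have hhpos : 0 < h := by linarith
    have hJh : Y / 2 ≤ |J.im - h| := by rcases hh with rfl | rfl <;> assumption
    have hbound : ∀ r ∈ Set.uIoc (2 : ℝ) c.re, ‖D.dobnerI t n s (r + (h : ℂ) * I)‖ ≤
        Real.exp (-(y ^ (4 / 3 : ℝ) / (5 * τ))) := by
      intro r hr
      have hr' : r ∈ Set.uIcc (2 : ℝ) c.re := Set.uIoc_subset_uIcc hr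
      have hrabs : |r| ≤ 2 * y ^ (3 / 5 : ℝ) := by
        rcases Set.mem_uIcc.1 hr' with ⟨h1, h2⟩ | ⟨h1, h2⟩
        · rw [abs_le]; constructor <;> linarith [le_abs_self c.re, neg_abs_le c.re]
        · rw [abs_le]; constructor <;> linarith [le_abs_self c.re, neg_abs_le c.re]
      -- `‖γ(r + ih)‖ ≤ 1`: `|r| ≤ 2y^{3/5} ≤ 4 h^{3/5}`, `h ≥ y/2 ≥ T₁`
      have hγ1 : ‖D.gamma (r + h * I)‖ ≤ 1 := by
        have hre : ((r : ℂ) + h * I).re = r := by simp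
        have him : ((r : ℂ) + h * I).im = h := by simp
        refine hbox _ ?_ ?_
        · rw [hre, him, abs_of_pos hhpos]
          have := rpow_three_fifths_le_two_mul hy0 (by linarith : y ≤ 2 * h)
          linarith
        · rw [him, abs_of_pos hhpos]; linarith
      have hJre0' : |(D.dobnerJ t s).re| ≤ y ^ (3 / 5 : ℝ) := by rw [← hJdef]; exact hJre0
      have hJh' : y ^ (2 / 3 : ℝ) / 2 ≤ |(D.dobnerJ t s).im - h| := by rw [← hJdef]; exact hJh
      exact D.norm_dobnerI_horizontal_le ht0 hn s hy0 hγ1 hrabs hℓ hJre0' hJh' hcondH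
    refine (intervalIntegral.norm_integral_le_of_norm_le_const hbound).trans ?_
    rw [mul_comm]
    refine mul_le_mul_of_nonneg_right ?_ (Real.exp_pos _).le
    calc |c.re - 2| ≤ |c.re| + |(2 : ℝ)| := abs_sub _ _
      _ = |c.re| + 2 := by rw [abs_two]
      _ ≤ 2 * y ^ (3 / 5 : ℝ) := hcre_abs
  -- Step 3: the outer part of the line `Re z = 2`
  set Kout : ℝ := M * Real.exp ((J.re - 2) ^ 2 / τ) * Real.exp (-(Y ^ 2 / (8 * τ))) with hKout
  have hKout0 : 0 ≤ Kout := by positivity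
  have hOuter : ‖(∫ v : ℝ, D.dobnerI t n s (2 + v * I)) -
      ∫ v in (c.im - Y)..(c.im + Y), D.dobnerI t n s (2 + v * I)‖ ≤
        Kout * Real.sqrt (2 * Real.pi * τ) := by
    have hint2 : Integrable fun v : ℝ ↦ D.dobnerI t n s (2 + v * I) :=
      D.integrable_dobnerI_two hk ht0 n s
    have hg := (integrable_exp_neg_sq_sub_div J.im hτ).const_mul Kout
    have h1 := norm_integral_sub_intervalIntegral_le (by linarith : c.im - Y ≤ c.im + Y) hint2 hg
      (fun v hv ↦ ?_) (fun v ↦ by positivity)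
    · rwa [MeasureTheory.integral_const_mul, integral_exp_neg_sq_sub_div J.im hτ] at h1
    · -- off `(Im c − Y, Im c + Y)`: `|v − Im J| ≥ Y/2`
      have hvJ : Y / 2 ≤ |v - J.im| := by
        rw [Set.mem_Ioo, not_and_or, not_lt, not_lt] at hv
        rcases hv with hv | hv
        · have : Y / 2 ≤ J.im - v := by
            have := (abs_le.1 hlam_im).2
            rw [hc_im] at hv; linarith [hJim.1]
          rw [abs_sub_comm]; exact this.trans (le_abs_self _)
        · have : Y / 2 ≤ v - J.im := by
            have := (abs_le.1 hlam_im).1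
            rw [hc_im] at hv; linarith
          exact this.trans (le_abs_self _)
      have hvJ' : Y / 2 ≤ |v - (D.dobnerJ t s).im| := by rw [← hJdef]; exact hvJ
      have h2 := D.norm_dobnerI_two_le ht0 hn s (M := M) (Y := Y) hM hY0.le v hvJ'
      rw [← hJdef] at h2
      have e : M * Real.exp ((J.re - 2) ^ 2 / |t|) * Real.exp (-(Y ^ 2 / (8 * |t|))) *
          Real.exp (-((v - J.im) ^ 2 / (2 * |t|))) = Kout * Real.exp (-((v - J.im) ^ 2 / (2 * τ))) := by
        rw [hKout]
      exact h2.trans e.le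
  -- Step 4: numerics
  have hcsqrt : cτ * Real.sqrt (2 * Real.pi * τ) ≤ 2 := by
    have h1 : Real.sqrt (2 * Real.pi * τ) ≤ Real.sqrt (4 * Real.pi * τ) :=
      Real.sqrt_le_sqrt (mul_le_mul_of_nonneg_right
        (mul_le_mul_of_nonneg_right (by norm_num) Real.pi_pos.le) hτ.le)
    have h2 : Real.sqrt (4 * Real.pi * τ) = 2 * Real.sqrt (Real.pi * τ) := by
      rw [show 4 * Real.pi * τ = 2 ^ 2 * (Real.pi * τ) by ring,
        Real.sqrt_mul (by norm_num) (Real.pi * τ), Real.sqrt_sq (by norm_num)]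
    have hs0 : 0 < Real.sqrt (Real.pi * τ) := Real.sqrt_pos.2 (by positivity)
    calc cτ * Real.sqrt (2 * Real.pi * τ) ≤ cτ * Real.sqrt (4 * Real.pi * τ) :=
          mul_le_mul_of_nonneg_left h1 hcτ0.le
      _ = 2 := by rw [h2, hcτ]; field_simp
  have hnum := dobner_contour_numerics_of_bound (Jre := J.re) (M := M) hτ hy1 hcτ0 hM1 hcsqrt hJre0
    h2y35 hYdef hcondO hcondHH
  -- Step 5: assemble
  rw [dobnerB, ← mul_sub, norm_mul, Complex.norm_real, Real.norm_eq_abs, abs_of_pos hcτ0]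
  have hsplit : (∫ v : ℝ, D.dobnerI t n s (2 + v * I)) -
      ∫ u in (-Y)..Y, D.dobnerI t n s (c + u * I) =
      ((∫ v : ℝ, D.dobnerI t n s (2 + v * I)) -
          ∫ v in (c.im - Y)..(c.im + Y), D.dobnerI t n s (2 + v * I)) -
        I * ((∫ r in (2 : ℝ)..c.re, D.dobnerI t n s (r + ((c.im - Y : ℝ) : ℂ) * I)) -
          ∫ r in (2 : ℝ)..c.re, D.dobnerI t n s (r + ((c.im + Y : ℝ) : ℂ) * I)) := by
    set Vfull := ∫ v : ℝ, D.dobnerI t n s (2 + v * I) with hVfull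
    set V := ∫ v in (c.im - Y)..(c.im + Y), D.dobnerI t n s (2 + v * I)
    set M' := ∫ u in (-Y)..Y, D.dobnerI t n s (c + u * I)
    set H1 := ∫ r in (2 : ℝ)..c.re, D.dobnerI t n s (r + ((c.im - Y : ℝ) : ℂ) * I)
    set H2 := ∫ r in (2 : ℝ)..c.re, D.dobnerI t n s (r + ((c.im + Y : ℝ) : ℂ) * I)
    linear_combination hident
  rw [hsplit]
  have hH1 := hH (c.im - Y) (Or.inl rfl)
  have hH2 := hH (c.im + Y) (Or.inr rfl)
  calc cτ * ‖((∫ v : ℝ, D.dobnerI t n s (2 + v * I)) -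
          ∫ v in (c.im - Y)..(c.im + Y), D.dobnerI t n s (2 + v * I)) -
        I * ((∫ r in (2 : ℝ)..c.re, D.dobnerI t n s (r + ((c.im - Y : ℝ) : ℂ) * I)) -
          ∫ r in (2 : ℝ)..c.re, D.dobnerI t n s (r + ((c.im + Y : ℝ) : ℂ) * I))‖
      ≤ cτ * (Kout * Real.sqrt (2 * Real.pi * τ) +
          2 * (2 * y ^ (3 / 5 : ℝ) * Real.exp (-(y ^ (4 / 3 : ℝ) / (5 * τ))))) := by
        refine mul_le_mul_of_nonneg_left ?_ hcτ0.le
        refine (norm_sub_le _ _).trans (add_le_add hOuter ?_)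
        rw [norm_mul, Complex.norm_I, one_mul]
        refine (norm_sub_le _ _).trans ?_
        push_cast at hH1 hH2 ⊢
        linarith
    _ = cτ * (Kout * Real.sqrt (2 * Real.pi * τ)) +
        cτ * (2 * (2 * y ^ (3 / 5 : ℝ) * Real.exp (-(y ^ (4 / 3 : ℝ) / (5 * τ))))) := by ring
    _ ≤ Real.exp (-(y ^ (4 / 3 : ℝ) / (18 * τ))) := by rw [hKout]; exact hnum

end ExtendedSelbergDatum

end Literature.NumberTheory.LFunctions

end
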